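import Summits.ValiantsHypothesis.ValiantsHypothesis.Theorems.VPBoundarySquareCoeffQueryFP
import Summits.ValiantsHypothesis.ValiantsHypothesis.Theorems.VPBoundarySquareCompletionLadder
import Summits.ValiantsHypothesis.ValiantsHypothesis.Theorems.VPBoundarySquareCHBooleanHalf
import HarnessLib

/-!
# VP-boundary square — the algebraic half of the `CH`-corner (`CH ⊆ P/poly ⟹ P_CH`)

Route `VPBoundarySquare`, corner `U := CHClosureDefinable`.  The completion ladder
(`Theorems/VPBoundarySquareCompletionLadder.lean`) isolated the spec-level transfer statement

  `P_CH :  VP ℂ = VNP ℂ →  every p-family g with a VCH⁰-specialisation presentation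
           gₙ = (map ℤ→ℂ Qₙ)(X, κₙ)  (Q ∈ VCH⁰: exponential format, coefficient function in
           CH/poly) is p-computable`

as the hypothesis `hP` of `collapseEmptiesBoundary_of_ch` / `valiant_of_Q_of_chCompletion`.
This file proves its **algebraic half** and closes the corner modulo GRH:

* `isPComputable_aeval_of_expFormat_of_PPoly` — the transfer engine: under `VP ℂ = VNP ℂ`, a
  family `Q` in exponential format with coefficient function in `P/poly` has p-computable
  specialisations `n ↦ (map ℤ→ℂ Qₙ)(X, κₙ)` (Bürgisser 2026, Lemma 4.11 / Cor. 4.12 in the binary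
  model, through Valiant's criterion with `P/poly` coefficients);
* `collapseDebordersCH_of_ch_subset_PPoly :  CH ⊆ P/poly → P_CH` (verbatim `hP` shape);
* `pCH_of_ERH : ERH → P_CH`, by the landed Boolean half
  `ch_subset_PPoly_of_ERH_of_collapse : ERH → VP ℂ = VNP ℂ → CH ⊆ P/poly`;
* `collapseEmptiesBoundary_of_ERH_of_chClosureDefinable : ERH → U_CH → CollapseEmptiesBoundary`,
  `valiant_of_ERH_of_Q_of_chClosureDefinable : ERH → Q → U_CH → ValiantsHypothesis`.

Architecture: Kronecker-pack `Qₙ` into a univariate family (digit base `2^{pₙ+1}`), feed it to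
Tavenas' `DefVNP.FamilyData` (`Theorems/VPBoundarySquareKroneckerVNP.lean`: substitution
identity and cost; `Theorems/VPBoundarySquareCoeffQueryFP.lean`: the `P/poly` bit language in the
`encUQuery` format), get `hPoly Φ ∈ VNP = VP` from `DefVNP.isVNPFamily_hPoly` and the collapse
(`isPComputable_of_isVNPFamily_of_vp_eq_vnp`), and transport the cost bound along the
substitution (`complexity_aeval_le`).

[cite: Burgisser2026HNC, Lemma 4.11 and Corollary 4.12 (pp. 13–14)]
[cite: Tavenas2014, Prop. 3.17] [cite: Burgisser2000, Cor. 1.2]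
-/

noncomputable section

set_option linter.dupNamespace false

open MvPolynomial
open Literature.Computability.AlgebraicComplexity
open Literature.Computability.Complexity

namespace Summit.ValiantsHypothesis.ValiantsHypothesis.Theorems.VPBoundarySquareCHAlgebraicHalf

open Summit.ValiantsHypothesis.ValiantsHypothesis.Theorems.VPBoundarySquareKroneckerVNP
open Summit.ValiantsHypothesis.ValiantsHypothesis.Theorems.VPBoundarySquareCoeffQueryFP

section Assembly

open Summit.ValiantsHypothesis.ValiantsHypothesis.Theses.VPBoundarySquare
open Summit.ValiantsHypothesis.ValiantsHypothesis.Theorems.VPBoundarySquarePresentableSplit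
open Summit.ValiantsHypothesis.ValiantsHypothesis.Theorems.VPBoundarySquareCompletionLadder
open Summit.ValiantsHypothesis.ValiantsHypothesis.Theorems.VPBoundarySquareCHBooleanHalf
open Literature.NumberTheory.LFunctions (ExtendedRiemannHypothesis)

/-- **Transfer engine (Bürgisser 2026, Lemma 4.11 / Cor. 4.12, binary model, with `P/poly`
coefficients).**  If `VP ℂ = VNP ℂ` and `Q` is a family of integer polynomials in exponential format
whose coefficient function lies in `P/poly`, then every specialisation
`n ↦ (map ℤ→ℂ Qₙ)(X₀,…,X_{w-1}, κₙ)` is p-computable.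
[cite: Burgisser2026HNC, Lemma 4.11 and Cor. 4.12 (pp. 13–14)] [cite: Tavenas2014, Prop. 3.17] -/
theorem isPComputable_aeval_of_expFormat_of_PPoly (hEq : VP ℂ = VNP ℂ) {w m : ℕ → ℕ}
    {Q : ∀ n, MvPolynomial (Fin (w n + m n)) ℤ} (hfmt : IsExpFormat Q)
    (hco : HasCoeffFnIn PPoly Q) (κ : ∀ n, Fin (m n) → ℂ) :
    IsPComputable fun n =>
      aeval (Fin.append X fun j => C (κ n j)) (map (Int.castRingHom ℂ) (Q n)) := by
  classical
  obtain ⟨p, hp, hpf⟩ := hfmt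
  obtain ⟨L, hL, hLQ⟩ := hco
  have hu : IsPBounded fun n => w n + m n := hp.mono fun n => (hpf n).1
  have hδ : IsPBounded fun n => p n + 1 := IsPBounded.add_holds hp (IsPBounded.const 1)
  have hud : IsPBounded fun n => (w n + m n) * (p n + 1) := IsPBounded.mul_holds hu hδ
  obtain ⟨pp, hpp⟩ := (isPBounded_iff_exists_polynomial_holds _).1 hud
  -- the overflow bit `2^(p n + 1)` of every coefficient is `false`
  have hfalse : ∀ n, coeffFnBit (Q n) 0 (2 ^ (p n + 1)) = false := by
    intro n
    obtain ⟨a, ha⟩ : ∃ a, 2 ^ (p n + 1) = a + 1 :=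
      ⟨2 ^ (p n + 1) - 1, by have := Nat.one_le_two_pow (n := p n + 1); omega⟩
    rw [ha]
    show (coeff 0 (Q n)).natAbs.testBit a = false
    apply Nat.testBit_lt_two_pow
    refine ((hpf n).2.2 0).trans_le (Nat.pow_le_pow_right two_pos ?_)
    have : 2 ^ (p n + 1) = 2 * 2 ^ p n := by ring
    omega
  obtain ⟨B, hB, hBQ⟩ := exists_encUQuery_language (fun n => p n + 1) hu hδ Q hL hLQ hfalse
  obtain ⟨pB, hSIZE⟩ := Set.mem_iUnion.1 hB
  obtain ⟨CF, hCF, hdec⟩ := hSIZE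
  -- Tavenas' data for the packed family
  obtain ⟨Φ, hΦf, hΦd, hΦr⟩ : ∃ Φ : DefVNP.FamilyData,
      (∀ n, Φ.f n = kron (2 ^ (p n + 1)) (Q n)) ∧ (∀ n, Φ.d n = (w n + m n) * (p n + 1)) ∧
      (∀ n, Φ.r n = p n) := by
    refine ⟨{ f := fun n => kron (2 ^ (p n + 1)) (Q n)
              d := fun n => (w n + m n) * (p n + 1)
              r := p
              hd := hud
              hr := hp
              p := pp
              B := B
              pB := pB
              CF := CF
              hCF := hCF
              hdec := hdec
              hp := fun n => (natDegree_kron_lt (Q n) (by positivity)).trans_le (by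
                rw [← pow_mul, mul_comm]
                exact Nat.pow_le_pow_right two_pos (hpp n))
              hB := fun n α j hα => ?_
              hdeg := fun n => by
                show (kron (2 ^ (p n + 1)) (Q n)).natDegree < 2 ^ ((w n + m n) * (p n + 1))
                rw [mul_comm, pow_mul]
                exact natDegree_kron_lt (Q n) (by positivity)
              hcoeff := fun n α => natAbs_coeff_kron_le (Q n) α (hpf n).2.2 },
      fun _ => rfl, fun _ => rfl, fun _ => rfl⟩
    show encUQuery n α j ∈ B ↔ sbit ((kron (2 ^ (p n + 1)) (Q n)).coeff α) j = true
    rw [hBQ n α j]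
    constructor
    · rintro ⟨hlt, hbit⟩
      rw [coeff_kron_of_lt (Q n) hlt, fs_symm_eq_dig hlt, sbit_coeff_eq_coeffFnBit]
      exact hbit
    · intro h
      by_cases hlt : α < (2 ^ (p n + 1)) ^ (w n + m n)
      · rw [coeff_kron_of_lt (Q n) hlt, fs_symm_eq_dig hlt, sbit_coeff_eq_coeffFnBit] at h
        exact ⟨hlt, h⟩
      · rw [coeff_kron, dif_neg hlt] at h
        cases j <;> simp [sbit] at h
  -- `hPoly Φ ∈ VNP`, hence p-computable under the collapse (after renaming to `Fin _` variables)
  have hVNP : IsVNPFamily (DefVNP.hPoly (k := ℂ) Φ) := DefVNP.isVNPFamily_hPoly Φ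
  let e : ∀ n, DefVNP.XZ (DefVNP.params Φ n) ≃
      Fin ((DefVNP.params Φ n).D + (DefVNP.params Φ n).R) := fun n => finSumFinEquiv
  have hPC : IsPComputable fun n => renameEquiv ℂ (e n) (DefVNP.hPoly (k := ℂ) Φ n) :=
    isPComputable_of_isVNPFamily_of_vp_eq_vnp hEq (hVNP.renameEquiv e)
  have hc1 : ∀ n, complexity (DefVNP.hPoly (k := ℂ) Φ n) ≤
      complexity (renameEquiv ℂ (e n) (DefVNP.hPoly (k := ℂ) Φ n)) := by
    intro n
    have hre : DefVNP.hPoly (k := ℂ) Φ n =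
        rename (e n).symm (renameEquiv ℂ (e n) (DefVNP.hPoly (k := ℂ) Φ n)) := by
      rw [← renameEquiv_apply, ← renameEquiv_symm, AlgEquiv.symm_apply_apply]
    conv_lhs => rw [hre]
    exact complexity_rename_le_holds' _ _
  -- the substitution identity
  have hid : ∀ n, aeval (Fin.append X fun j => C (κ n j)) (map (Int.castRingHom ℂ) (Q n)) =
      aeval (theta ℂ Φ n (hΦd n) (Fin.append X fun j => C (κ n j)))
        (DefVNP.hPoly (k := ℂ) Φ n) := by
    intro n
    rw [aeval_theta_hPoly ℂ Φ n (hΦd n) (Q n) (hΦf n)]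
    intro e he i
    calc e i ≤ degreeOf i (Q n) := monomial_le_degreeOf i he
      _ ≤ (Q n).totalDegree := degreeOf_le_totalDegree _ _
      _ ≤ 2 ^ p n := (hpf n).2.1
      _ < 2 ^ (p n + 1) := Nat.pow_lt_pow_right (by norm_num) (by omega)
  -- the cost bound
  have hbound : ∀ n,
      complexity (aeval (Fin.append X fun j => C (κ n j)) (map (Int.castRingHom ℂ) (Q n))) ≤
        complexity (renameEquiv ℂ (e n) (DefVNP.hPoly (k := ℂ) Φ n)) +
          (w n + m n) * (p n + 1) * (p n + 1) := by
    intro n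
    rw [hid n]
    refine (complexity_aeval_le _ _).trans ?_
    have hs := sum_complexity_theta_le (k := ℂ) Φ n (hΦd n)
      (Fin.append X fun j => C (κ n j)) (complexity_append_X_C (κ n))
    have h1 := hc1 n
    rw [hΦd n] at hs
    omega
  exact (IsPBounded.add_holds hPC (IsPBounded.mul_holds hud hδ)).mono hbound

/-- **`CH ⊆ P/poly ⟹ P_CH`** — the algebraic half of the `CH`-corner, in the verbatim shape of
the hypothesis `hP` of `collapseEmptiesBoundary_of_ch` / `valiant_of_Q_of_chCompletion`: under the
collapse every p-family with a `VCH⁰`-specialisation presentation is p-computable, provided the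
counting hierarchy has polynomial-size circuits (then `CH/poly ⊆ P/poly` and the engine applies).
[cite: Burgisser2026HNC, Lemma 4.11 and Cor. 4.12 (pp. 13–14)] -/
theorem collapseDebordersCH_of_ch_subset_PPoly (hCH : CH ⊆ PPoly) :
    VP ℂ = VNP ℂ → ∀ (w : ℕ → ℕ) (g : ∀ n, MvPolynomial (Fin (w n)) ℂ), IsPFamily g →
      (∃ (m : ℕ → ℕ) (Q : ∀ n, MvPolynomial (Fin (w n + m n)) ℤ) (κ : ∀ n, Fin (m n) → ℂ),
        IsVCH0Family Q ∧ ∀ n, g n = MvPolynomial.aeval (Fin.append MvPolynomial.X fun j =>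
          MvPolynomial.C (κ n j)) (MvPolynomial.map (Int.castRingHom ℂ) (Q n))) →
      IsPComputable g := by
  intro hEq w g _ hpres
  obtain ⟨m, Q, κ, hQ, hg⟩ := hpres
  have h := isPComputable_aeval_of_expFormat_of_PPoly hEq hQ.1
    (hQ.2.mono (polyAdvice_subset_PPoly hCH)) κ
  have hfun : g = fun n => MvPolynomial.aeval (Fin.append MvPolynomial.X fun j =>
      MvPolynomial.C (κ n j)) (MvPolynomial.map (Int.castRingHom ℂ) (Q n)) := funext hg
  rw [hfun]
  exact h

/-- **`ERH ⟹ P_CH`**: with the landed Boolean half `ERH → VP ℂ = VNP ℂ → CH ⊆ P/poly`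
(`ch_subset_PPoly_of_ERH_of_collapse`, Bürgisser 2000 Cor. 1.2 + Thm. 1.1 chain) the transfer
statement `P_CH` holds outright modulo GRH. [cite: Burgisser2000, Cor. 1.2]
[cite: Burgisser2026HNC, Cor. 4.12 (p. 14)] -/
theorem pCH_of_ERH (hGRH : ExtendedRiemannHypothesis) :
    VP ℂ = VNP ℂ → ∀ (w : ℕ → ℕ) (g : ∀ n, MvPolynomial (Fin (w n)) ℂ), IsPFamily g →
      (∃ (m : ℕ → ℕ) (Q : ∀ n, MvPolynomial (Fin (w n + m n)) ℤ) (κ : ∀ n, Fin (m n) → ℂ),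
        IsVCH0Family Q ∧ ∀ n, g n = MvPolynomial.aeval (Fin.append MvPolynomial.X fun j =>
          MvPolynomial.C (κ n j)) (MvPolynomial.map (Int.castRingHom ℂ) (Q n))) →
      IsPComputable g :=
  fun hEq => collapseDebordersCH_of_ch_subset_PPoly (ch_subset_PPoly_of_ERH_of_collapse hGRH hEq) hEq

/-- **The `CH`-corner closes `P` modulo GRH**: `ERH → CHClosureDefinable → CollapseEmptiesBoundary`
(the route's rank-2 crux from the single definability statement `U_CH`).
[cite: Burgisser2026HNC, Thm. 1.2 and Cor. 4.12] -/
theorem collapseEmptiesBoundary_of_ERH_of_chClosureDefinable (hGRH : ExtendedRiemannHypothesis)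
    (hU : CHClosureDefinable) : CollapseEmptiesBoundary :=
  collapseEmptiesBoundary_of_ch hU (pCH_of_ERH hGRH)

/-- **Summit from the `CH`-corner modulo GRH**: `ERH → Q → U_CH → VP ℂ ≠ VNP ℂ`.
[cite: Burgisser2026HNC, Thm. 1.2 and Cor. 4.12] [cite: Burgisser2000, Cor. 1.2] -/
theorem valiant_of_ERH_of_Q_of_chClosureDefinable (hGRH : ExtendedRiemannHypothesis)
    (hQ : EmptyBoundarySeparates) (hU : CHClosureDefinable) : ValiantsHypothesis :=
  valiant_of_Q_of_chCompletion hQ hU (pCH_of_ERH hGRH)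

end Assembly

end Summit.ValiantsHypothesis.ValiantsHypothesis.Theorems.VPBoundarySquareCHAlgebraicHalf
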